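import Literature.MathematicalPhysics.QuantumFieldTheory.Balaban1983to89.B9Thm311LaplaceAkPositiveDiagonal
import Literature.MathematicalPhysics.QuantumFieldTheory.Balaban1983to89.B9Eq3153FrakGVariational

/-!
# `Balaban1983to89.B9Eq3153FrakGkBoundDiagonal` — T. Bałaban, *Propagators for lattice gauge theories in a background field*, Commun. Math. Phys. **99**
# (1985) 389–434 [Balaban1985BackgroundPropagators] Thm 3.13 p. 426 with (3.153) p. 426, Thm 3.11 p. 416, (3.26) p. 395 AT `k = n+1` AVERAGING LEVELS ON
# PRINT's DIAGONAL `ηL^{n+1} = 1`: **THE THREE GREEN's LETTERS `G_k(U)`, `H_{1,k}(U)Q_k(U)G_k(U)`, `𝔊_k(U)` OF PRINT's `k`-TH-STEP OPERATOR ARE BOUNDED IN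
# `L²` TOGETHER WITH THEIR FLAT `D`-ROWS BY `(d,a)`-NUMBERS — `∃ α₀ C` BEFORE EVERY LATTICE ∕ HEIGHT ∕ WEIGHT ∕ VOLUME ∕ BACKGROUND BINDER, NO OPERATOR
# LETTER DISPLAYED** (the owner's `B9Thm311LaplaceAkPositiveDiagonal` ∕ `B9Thm311SmallFieldCoercivityTowerClosed` composed with `B9Eq3153FrakGVariational`)

statement-level skeleton of published theorems with citation tags; proofs where landed; nothing here is a claim about the Yang–Mills mass gap

CITATION HEADER (lean-in-tree rule).  Audit cell `pub-balaban`, sub-cell `t4`, BINDER row NE9; filed by the row OWNER lineage `b2b-balaban-t4-ne9-p1`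
(gen 86).  Sources READ first-hand by this lineage in the held text layer [Balaban1985BackgroundPropagators] (`paper:balaban1985-cmp99-background-propagators`,
journal page = PDF page + 388) pp. 395–396 ((3.26), (3.35)), 400 (Thm 3.4), 416 (Thm 3.11), 425–426 ((3.147)–(3.153), Thm 3.13).

THE PRINT (verbatim, text layer).  p. 426: *«The formulas (3.147), (3.153) permit us to reduce properties of the operators 𝔓, 𝔊 to the corresponding properties
of the operators G′, (Q′G′²Q′*)⁻¹, G₁, (QG₁Q*)⁻¹.  Especially for 𝔊 we have, assuming (3.132)  Theorem 3.13. If an external gauge field configuration U satisfies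
the regularity conditions (3.35), (3.36) for α₀ sufficiently small, then Theorems 3.3, 3.10, 3.11 hold for the propagator 𝔊, with the exception of the inequality
in (3.42) involving the covariant Laplace operator.»*; p. 416, Thm 3.11: *«There exist constants α₀, γ₀ > 0 such that … the operators Δ′_a, G′, (Q′G′²Q′*)⁻¹, Δ_a, G
are positive definite»*.

WHY THIS FILE (cell context; the owner's TOWER-R-PROGRAMME §5).  The `k`-level UNIFORM BALL (`Support/NE9CurChartTowerUniformBall`) takes `C_H`, `C_G` from
`B9Eq3126H1BoundTower.exists_H1k_frakGk_(CLM_)bound_of_small_field`, whose `L²` constants carry `‖Δ^{(k)}_a‖ ∝ |η|⁻²`, `‖D‖ ∝ |η|⁻¹` and the adjoint modulus of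
`Q_k` — `L^{4(n+1)}` on the diagonal.  The owner's g85 files closed the COERCIVITY side letter-free; `B9Eq3153FrakGVariational` turns coercivity ALONE into bounds of
the three pieces of (3.153).  This file is the junction: on print's diagonal, under print's running windows (3.35), `‖𝔊_k(U)‖_{L²→L²} ≤ 16∕γ(d,a)` with its flat
`D`-rows — the `H`-letter, test family, section, `M_T`, `M_D`, `M_Q`, `μ_Q` ALL GONE.  Still displayed for the ball: `H_{1,k}(U)` alone (NE9 leaf-02's `B9Eq3126KFloor*`)
and the (N)-reading's volume factor ∕ `M_∇` (`B11Eq117TransformationNorm`; print: Thm 3.13's DECAY, not here).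

WHAT IS PROVED (sorry-free; 0 `def`; [folklore] composition BY NAME + threshold arithmetic; nothing of [B9] asserted as printed).  Binders as in
`B9Thm311LaplaceAkPositiveDiagonal` (E162's per-level data `αU ≤ 1∕64`, `hU1`, `hreg`; windows; `hRS`); `curl₁`∕`div₁` = the FLAT covariant curl ∕ divergence
(prefactor `η⁻¹`, transporters `1`) as in `B9Thm311SmallFieldCoercivityTowerClosed`.
* §1 **`exists_energy_letters_diagonal_closed`** — `∃ α₀ γ₁ > 0` (`γ₁ = γ(d,a)∕4`, `α₀` closed in `(d, a, L, M_φ, M_φ′, r, C_τ, ρ_w)`) BEFORE the binders, then for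
  every `x`: (i) STRONG COERCIVITY WITH CURVATURE `γ₁(‖curl₁x‖² + ‖div₁x‖² + ‖x‖²) ≤ re⟨x, Δ^{(n+1)}_a(U)x⟩`; (ii) the form letter `‖R_k(U)(D*_Ux)‖² ≤ 2·re⟨x, Δ_a x⟩`;
  (iii) `a‖Q_k(U)x‖² ≤ 2·re⟨x, Δ_a x⟩` (`B9Eq3153FrakGVariational` §5 at `K = K_cα ≤ γ₁`).
* §2 **`exists_norm_G1k_rows_le_diagonal_closed`** — `∃ α₀ C > 0` (`C = γ₁⁻¹`) before the binders; for ANY positivity witness `hpos`: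
  `‖curl₁(G_k(U)y)‖ ≤ C‖y‖`, `‖div₁(G_k(U)y)‖ ≤ C‖y‖` (the mass row `‖G_k(U)y‖ ≤ γ₁⁻¹‖y‖` is `B9Thm311LaplaceAkPositiveDiagonal.exists_norm_G1k_le_diagonal_closed`).
* §3 **`exists_norm_H1k_Qk_G1k_le_diagonal_closed`** — `∃ α₀ C > 0` (`C = γ₁⁻¹`); for `Δ^{(n+1)}_a(U)` SYMMETRIC (`hsymm`; discharged for a unitary background and a
  `*`-trace by `B9Eq326OperatorTower.laplaceAk_isSymmetric`), ANY `hpos` and ANY onto-witness `hQ` of `Q_k(U)`: the three rows of `H_{1,k}(U)(Q_k(U)(G_k(U)y))`.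
* §4 **`exists_norm_frakGk_le_diagonal_closed`** — `∃ α₀ C > 0` (`C = 4γ₁⁻¹ = 16∕γ(d,a)`); under `hsymm`, ANY `hpos`, ANY `hQ`:
  `‖𝔊_k(U)x‖ ≤ C‖x‖`, `‖curl₁(𝔊_k(U)x)‖ ≤ C‖x‖`, `‖div₁(𝔊_k(U)x)‖ ≤ C‖x‖` for `𝔊_k(U) = B11Eq103H1Complex.frakGLatticeK hpos hQ` at the tower letters
  (`B9Eq326OperatorTower.frakGk` is the instance `hQ := QkW_surjective …`).
HONEST SCOPE.  Thm 3.13's `L²`∕energy clause ONLY on the diagonal `ηL^{n+1} = 1`; no kernel bound (3.42)–(3.47), no decay (Thm 3.10), no Hölder norms, NOT the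
(N)-reading (volume factor load-bearing there); the small-field WINDOWS, `hRS`, the trace letter `C_τ`, the weight ratio `ρ_w` and (§3–§4) the symmetry of `Δ_a` stay
HYPOTHESES; crude constants.  NOT summit progress (cell pub-balaban: NE9 NOT PRINTED ∕ NOT PROVED; «NE9 ⇐ the named binders»; row WALLED ON A MODEL (O-NE9-1; #5
UNRULED); spine PROVED 0∕9; rung (B)+1 finite T⁴ — NOT infinite volume, NOT mass gap, NOT BetaPertH, NOT Clay).  HONEST DEPENDENCY (cell line): continuum YM on T⁴ ⇐
BetaPertH ∧ nine spine estimates (0/9 proved); BetaPertH ⇐ (D1) ∧ (D4) ∧ CAP+tail; G-an2-4 gates asym, D1 and NE2/3/4.  NEW file; nothing modified.  Net new unproved facts: 0.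
-/

noncomputable section

open scoped InnerProductSpace ComplexConjugate BigOperators

namespace Literature.MathematicalPhysics.QuantumFieldTheory.Balaban1983to89.B9Eq3153FrakGkBoundDiagonal

open B4Sect5Torus (TSite)
open B9SectCLatticeCarrier (Bond)
open B11Eq103H1Complex (SiteL2K BondL2K covDerivL2K covDivL2K laplaceALatticeK laplaceAK G1LatticeK H1LatticeK frakGLatticeK KinvLatticeK
  adjoint_covDerivL2K adjoint_injective_of_surjective projR_projR laplaceALatticeK_G1LatticeK)
open B9Eq310HessianOperator (adTransportW principalOpK curvOp hessOp hessOp_apply covCurlL2K principalOpK_eq_comp inner_covCoCurlL2K_covCurlL2K)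
open B9Eq310DeltaPrime (plaqHolU)
open B9Eq315QTorus (perCfg cornerSite)
open B9Eq315QTower (towerP UlevOf)
open B9Eq326OperatorTower (laplaceAk QkW RofUk RofUk_isSymmetric)
open B7Prop1Explicit (U1 Wcx boxVec)
open B9Ineq369CurvatureSmall (norm_inner_curvOp_self_le)
open B9Thm311SmallFieldCoercivityTowerClosed (exists_strong_coercive_tower_diagonal_closed)
open B9Eq3153FrakGVariational (norm_sq_RDstar_le re_inner_laplaceAK_eq norm_apply_G1K_le norm_H1K_Q_G1K_le norm_apply_H1K_Q_G1K_le
  norm_frakGLin_le_of_energy norm_apply_frakGLin_le_of_energy)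

/-- Rows from a strong coercivity `γ(c² + e² + x²) ≤ E`: `γx² ≤ E`, `c² ≤ γ⁻¹E`, `e² ≤ γ⁻¹E`. [folklore] -/
private theorem rows_of_strong {γ c e x E : ℝ} (hγ : 0 < γ) (h : γ * (c ^ 2 + e ^ 2 + x ^ 2) ≤ E) :
    γ * x ^ 2 ≤ E ∧ c ^ 2 ≤ γ⁻¹ * E ∧ e ^ 2 ≤ γ⁻¹ * E := by
  have hc := mul_nonneg hγ.le (sq_nonneg c); have he := mul_nonneg hγ.le (sq_nonneg e); have hx := mul_nonneg hγ.le (sq_nonneg x)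
  refine ⟨by linarith, ?_, ?_⟩ <;> rw [inv_mul_eq_div, le_div_iff₀' hγ] <;> linarith

variable {d : ℕ} (L : ℕ) [NeZero L] (hL : 1 ≤ L)
  {𝔸 : Type*} [NormedRing 𝔸] [NormedAlgebra ℂ 𝔸] [CompleteSpace 𝔸] [NormOneClass 𝔸] [StarRing 𝔸] [NormedStarGroup 𝔸] [StarModule ℂ 𝔸]
  {W : Type*} [NormedAddCommGroup W] [InnerProductSpace ℂ W] [FiniteDimensional ℂ W] (φ : W ≃ₗ[ℂ] 𝔸)
  {Mφ Mφ' : ℝ} (hMφ : 0 ≤ Mφ) (hMφ' : 0 ≤ Mφ') (hφ : ∀ w, ‖φ w‖ ≤ Mφ * ‖w‖) (hφ' : ∀ X, ‖φ.symm X‖ ≤ Mφ' * ‖X‖)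
  {a : ℝ} (ha : 0 < a) {r : ℝ} (hr0 : 0 ≤ r) (hr1 : r < 1)
  (τ : 𝔸 →ₗ[ℂ] ℂ) {Cτ : ℝ} (hτ : ∀ X, ‖τ X‖ ≤ Cτ * ‖X‖) (hCτ : 0 ≤ Cτ) {ρw : ℝ} (hρw : 0 ≤ ρw)

include hMφ hMφ' hφ hφ' ha hr0 hr1 hτ hCτ hρw

/-! ## §1 The energy letters on the diagonal: strong coercivity with curvature, the `RD*`- and the `Q`-letter -/

set_option maxHeartbeats 400000 in
/-- **THE ENERGY LETTERS OF PRINT's `k`-TH-STEP OPERATOR ON THE DIAGONAL, NO OPERATOR LETTER DISPLAYED**: there are `α₀, γ₁ > 0` (`γ₁ = γ(d,a)∕4`, `α₀` closed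
in `(d, a, L, M_φ, M_φ′, r, C_τ, ρ_w)`) such that for every `n`, `η` (`ηL^{n+1} = 1`), `c₀, c₁` (`c₀(L^{n+1})^d = c₁`, `|η|^d∕c₀ ≤ ρ_w`), `m`, background `U` of E162's
data with `hRS`, `U(b) ∈ U1`, `‖U(b) − 1‖ ≤ αη`, `‖U(∂p) − 1‖ ≤ αη²`, `‖Ū^j(b) − 1‖ ≤ ε_j ≤ αr^j`, `0 ≤ α ≤ α₀`, and every `x`:
(i) `γ₁(‖curl₁x‖² + ‖div₁x‖² + ‖x‖²) ≤ re⟨x, Δ^{(n+1)}_a(U)x⟩` (STRONG coercivity of the FULL operator: `B9Thm311SmallFieldCoercivityTowerClosed`'s principal form `γ′`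
minus the curvature form bound `K_cα‖x‖² ≤ (γ′∕2)‖x‖²`, `B9Ineq369CurvatureSmall`); (ii) `‖R_k(U)(D*_Ux)‖² ≤ 2·re⟨x, Δ_a x⟩`; (iii) `a‖Q_k(U)x‖² ≤ 2·re⟨x, Δ_a x⟩`
((ii)∕(iii): `B9Eq3153FrakGVariational.re_inner_laplaceAK_eq` for `Δ_a = Δ + DRD* + aQ†Q` with `re⟨x, Δx⟩ = ‖curl_Ux‖² + re⟨x, Δ′(U)x⟩ ≥ −(γ′∕2)‖x‖²`).
[cite: Balaban1985BackgroundPropagators, Thm 3.11 p.416, (3.26) p.395, (3.69) p.404, (3.35) p.396] -/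
theorem exists_energy_letters_diagonal_closed :
    ∃ α₀ γ₁ : ℝ, 0 < α₀ ∧ 0 < γ₁ ∧ ∀ (n : ℕ) (η : ℝ), η * (L : ℝ) ^ (n + 1) = 1 →
      ∀ (c₀ c₁ : ℝ) [Fact (0 < c₀)] [Fact (0 < c₁)], c₀ * ((L : ℝ) ^ (n + 1)) ^ d = c₁ → |η| ^ d / c₀ ≤ ρw →
      ∀ (m : Fin d → ℕ) [∀ i, NeZero (m i)] (U : Bond d (towerP L m (n + 1)) → 𝔸ˣ) (αU : ℕ → ℝ) (hα1 : ∀ j, αU j ≤ 1 / 64)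
        (hU1 : ∀ (j : ℕ) (x : B7Prop1Explicit.Site d) (κ : Fin d), perCfg (towerP L m (j + 1)) (UlevOf L m (n + 1) U j) x κ ∈ U1 𝔸)
        (hreg : ∀ (j : ℕ) (y : TSite d (towerP L m j)) (κ : Fin d) (r : Fin d → Fin L),
          ‖((Wcx L (perCfg (towerP L m (j + 1)) (UlevOf L m (n + 1) U j)) (cornerSite L y) κ (boxVec L r) : 𝔸ˣ) : 𝔸) - 1‖ ≤ αU j)
        (εU : ℕ → ℝ), (∀ j, 0 ≤ εU j) → (∀ (j : ℕ) (b : Bond d (towerP L m (j + 1))), ‖(UlevOf L m (n + 1) U j b : 𝔸) - 1‖ ≤ εU j) →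
      ∀ {α : ℝ}, 0 ≤ α → α ≤ α₀ →
        (∀ (b : Bond d (towerP L m (n + 1))) (v u : W), ⟪adTransportW φ U b v, u⟫_ℂ = ⟪v, adTransportW φ (fun b => (U b)⁻¹) b u⟫_ℂ) →
        (∀ b, U b ∈ U1 𝔸) → (∀ b, ‖(U b : 𝔸) - 1‖ ≤ α * η) →
        (∀ p : B9SectCLatticeCarrier.Plaq d (towerP L m (n + 1)), ‖(plaqHolU U p : 𝔸) - 1‖ ≤ α * η ^ 2) →
        (∀ j < n + 1, εU j ≤ α * r ^ j) →
        ∀ x : BondL2K ℂ d (towerP L m (n + 1)) c₀ W,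
          γ₁ * (‖covCurlL2K ℂ c₀ ((η : ℂ))⁻¹ (adTransportW φ (fun _ : Bond d (towerP L m (n + 1)) => (1 : 𝔸ˣ))) x‖ ^ 2 +
              ‖covDivL2K ℂ c₀ ((η : ℂ))⁻¹ (adTransportW φ fun _ : Bond d (towerP L m (n + 1)) => (1 : 𝔸ˣ)⁻¹) x‖ ^ 2 + ‖x‖ ^ 2) ≤
            RCLike.re ⟪x, laplaceAk L m n φ η U hL αU hα1 hU1 hreg τ (c₀ := c₀) (c₁ := c₁) a x⟫_ℂ ∧
          ‖RofUk L m n φ η U (covDivL2K ℂ c₀ ((η : ℂ))⁻¹ (adTransportW φ fun b => (U b)⁻¹) x)‖ ^ 2 ≤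
            2 * RCLike.re ⟪x, laplaceAk L m n φ η U hL αU hα1 hU1 hreg τ (c₀ := c₀) (c₁ := c₁) a x⟫_ℂ ∧
          a * ‖QkW L m n φ U hL αU hα1 hU1 hreg (c₁ := c₁) x‖ ^ 2 ≤
            2 * RCLike.re ⟪x, laplaceAk L m n φ η U hL αU hα1 hU1 hreg τ (c₀ := c₀) (c₁ := c₁) a x⟫_ℂ := by
  obtain ⟨α₁, γ', hα₁, hγ', H⟩ := exists_strong_coercive_tower_diagonal_closed L hL φ hMφ hMφ' hφ hφ' ha hr0 hr1
  obtain ⟨Kc, hKcdef⟩ : ∃ Kc : ℝ, Kc = 32 * d * Cτ * Mφ ^ 2 * ρw := ⟨_, rfl⟩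
  have hKc : 0 ≤ Kc := by rw [hKcdef]; positivity
  refine ⟨min α₁ (γ' / (Kc + 1) / 2), γ' / 2, lt_min hα₁ (by positivity), by positivity, ?_⟩
  intro n η hηL c₀ c₁ _ _ hw hρ m _ U αU hα1 hU1 hreg εU hεU hUε α hα0 hαle hRS hUb hUη hpl hεg x
  have hc₀ : 0 < c₀ := Fact.out
  have hLr : (0 : ℝ) < (L : ℝ) ^ (n + 1) := pow_pos (by exact_mod_cast Nat.pos_of_ne_zero (NeZero.ne L)) _
  have hηL0 : 0 < η * (L : ℝ) ^ (n + 1) := by rw [hηL]; exact one_pos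
  have hη0 : 0 < η := pos_of_mul_pos_left hηL0 hLr.le
  have hc : conj ((η : ℂ))⁻¹ = ((η : ℂ))⁻¹ := by rw [map_inv₀, Complex.conj_ofReal]
  have hγU := H n η hηL c₀ c₁ hw m U αU hα1 hU1 hreg εU hεU hUε hα0 (hαle.trans (min_le_left _ _)) hRS hUb hUη hεg x
  -- abbreviations
  set rows := ‖covCurlL2K ℂ c₀ ((η : ℂ))⁻¹ (adTransportW φ (fun _ : Bond d (towerP L m (n + 1)) => (1 : 𝔸ˣ))) x‖ ^ 2 +
      ‖covDivL2K ℂ c₀ ((η : ℂ))⁻¹ (adTransportW φ fun _ : Bond d (towerP L m (n + 1)) => (1 : 𝔸ˣ)⁻¹) x‖ ^ 2 with hrows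
  have hrows0 : 0 ≤ rows := by rw [hrows]; positivity
  -- the curvature part: `‖⟨x, Δ′(U)x⟩‖ ≤ K_c·α·‖x‖² ≤ (γ′/2)‖x‖²`
  have hUb' : ∀ b : Bond d (towerP L m (n + 1)), ‖(U b : 𝔸)‖ ≤ 1 ∧ ‖(((U b)⁻¹ : 𝔸ˣ) : 𝔸)‖ ≤ 1 := fun b => B7Prop1Explicit.mem_U1.1 (hUb b)
  have hnη : ‖((η : ℂ))⁻¹‖ ^ 2 * (α * η ^ 2) = α := by
    rw [norm_inv, Complex.norm_real, Real.norm_eq_abs, abs_of_pos hη0]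
    field_simp
  have hK := norm_inner_curvOp_self_le φ hτ hCτ hφ η hUb' hpl (by positivity : 0 ≤ α * η ^ 2) x
  rw [hnη] at hK
  have hKα : 32 * d * Cτ * Mφ ^ 2 * (|η| ^ d / c₀) * α ≤ γ' / 2 := by
    have h1 : 32 * d * Cτ * Mφ ^ 2 * (|η| ^ d / c₀) * α ≤ Kc * α := by
      rw [hKcdef]; exact mul_le_mul_of_nonneg_right (mul_le_mul_of_nonneg_left hρ (by positivity)) hα0
    have hαt : α ≤ γ' / (Kc + 1) / 2 := hαle.trans (min_le_right _ _)
    have h2 : Kc * α ≤ Kc * (γ' / (Kc + 1) / 2) := mul_le_mul_of_nonneg_left hαt hKc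
    have h3 : Kc * (γ' / (Kc + 1) / 2) ≤ γ' / 2 := by
      rw [mul_div_assoc', mul_div_assoc', div_div, div_le_div_iff₀ (by positivity) (by norm_num)]
      nlinarith [hγ'.le, hKc]
    linarith
  have hcurv : -(γ' / 2 * ‖x‖ ^ 2) ≤ RCLike.re ⟪x, curvOp φ τ η U x⟫_ℂ := by
    have h := (RCLike.abs_re_le_norm ⟪x, curvOp φ τ η U x⟫_ℂ).trans (hK.trans (mul_le_mul_of_nonneg_right hKα (sq_nonneg _)))
    rw [abs_le] at h
    exact h.1
  -- `re⟨x, Δ(U)x⟩ = ‖curl_U x‖² + re⟨x, Δ′(U)x⟩ ≥ −(γ′/2)‖x‖²`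
  have hΔ : ∀ y : BondL2K ℂ d (towerP L m (n + 1)) c₀ W, -(γ' / 2 * ‖y‖ ^ 2) ≤ RCLike.re ⟪y, hessOp φ η U τ y⟫_ℂ := by
    intro y
    have hKy := norm_inner_curvOp_self_le φ hτ hCτ hφ η hUb' hpl (by positivity : 0 ≤ α * η ^ 2) y
    rw [hnη] at hKy
    have hcy : -(γ' / 2 * ‖y‖ ^ 2) ≤ RCLike.re ⟪y, curvOp φ τ η U y⟫_ℂ := by
      have h := (RCLike.abs_re_le_norm ⟪y, curvOp φ τ η U y⟫_ℂ).trans (hKy.trans (mul_le_mul_of_nonneg_right hKα (sq_nonneg _)))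
      rw [abs_le] at h
      exact h.1
    have hpr : RCLike.re ⟪y, principalOpK φ η U y⟫_ℂ =
        ‖covCurlL2K ℂ c₀ ((η : ℂ))⁻¹ (adTransportW φ U) y‖ ^ 2 := by
      rw [principalOpK_eq_comp, LinearMap.comp_apply, inner_covCoCurlL2K_covCurlL2K _ hc _ _ hRS]
      norm_cast
    rw [hessOp_apply, inner_add_right, map_add, hpr]
    nlinarith [sq_nonneg ‖covCurlL2K ℂ c₀ ((η : ℂ))⁻¹ (adTransportW φ U) y‖]
  -- the full operator splits as principal + curvature
  have hsplit : laplaceAk L m n φ η U hL αU hα1 hU1 hreg τ (c₀ := c₀) (c₁ := c₁) a x =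
      laplaceALatticeK ((η : ℂ))⁻¹ (adTransportW φ U) (adTransportW φ fun b => (U b)⁻¹) (principalOpK φ η U)
        (RofUk L m n φ η U) (QkW L m n φ U hL αU hα1 hU1 hreg (c₁ := c₁)) a x + curvOp φ τ η U x := by
    rw [laplaceAk]
    simp only [laplaceALatticeK, B11Eq103H1Complex.laplaceAK_apply, hessOp_apply]
    abel
  have hγrows : 0 ≤ γ' * rows := mul_nonneg hγ'.le hrows0
  have hstrong : γ' / 2 * (rows + ‖x‖ ^ 2) ≤ RCLike.re ⟪x, laplaceAk L m n φ η U hL αU hα1 hU1 hreg τ (c₀ := c₀) (c₁ := c₁) a x⟫_ℂ := by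
    rw [hsplit, inner_add_right, map_add]
    linarith
  have hx2 : γ' / 2 * ‖x‖ ^ 2 ≤ RCLike.re ⟪x, laplaceAk L m n φ η U hL αU hα1 hU1 hreg τ (c₀ := c₀) (c₁ := c₁) a x⟫_ℂ := by
    linarith
  -- the structure letters for `B9Eq3153FrakGVariational` §5
  have hadj : ∀ (y : BondL2K ℂ d (towerP L m (n + 1)) c₀ W) (z : BondL2K ℂ d m c₁ W),
      ⟪QkW L m n φ U hL αU hα1 hU1 hreg (c₁ := c₁) y, z⟫_ℂ = ⟪y, LinearMap.adjoint (QkW L m n φ U hL αU hα1 hU1 hreg (c₁ := c₁)) z⟫_ℂ :=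
    fun y z => (LinearMap.adjoint_inner_right _ y z).symm
  have hDD : ∀ (s : SiteL2K ℂ d (towerP L m (n + 1)) c₀ W) (y : BondL2K ℂ d (towerP L m (n + 1)) c₀ W),
      ⟪covDerivL2K ℂ c₀ ((η : ℂ))⁻¹ (adTransportW φ U) s, y⟫_ℂ = ⟪s, covDivL2K ℂ c₀ ((η : ℂ))⁻¹ (adTransportW φ fun b => (U b)⁻¹) y⟫_ℂ := by
    intro s y
    rw [← adjoint_covDerivL2K ((η : ℂ))⁻¹ hc _ _ hRS, LinearMap.adjoint_inner_right]
  have hRsym : ∀ s t : SiteL2K ℂ d (towerP L m (n + 1)) c₀ W, ⟪RofUk L m n φ η U s, t⟫_ℂ = ⟪s, RofUk L m n φ η U t⟫_ℂ :=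
    fun s t => RofUk_isSymmetric L m n φ η U s t
  have hRR : ∀ s : SiteL2K ℂ d (towerP L m (n + 1)) c₀ W, RofUk L m n φ η U (RofUk L m n φ η U s) = RofUk L m n φ η U s :=
    fun s => projR_projR _ _ s
  have ha' : 0 ≤ RCLike.re ((a : ℝ) : ℂ) := by simp [ha.le]
  have hform := re_inner_laplaceAK_eq (𝕜 := ℂ) (Δ := hessOp φ η U τ) (D := covDerivL2K ℂ c₀ ((η : ℂ))⁻¹ (adTransportW φ U))
    (R := RofUk L m n φ η U) (Dstar := covDivL2K ℂ c₀ ((η : ℂ))⁻¹ (adTransportW φ fun b => (U b)⁻¹))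
    (Q := QkW L m n φ U hL αU hα1 hU1 hreg (c₁ := c₁)) (a := ((a : ℝ) : ℂ)) hadj hDD hRsym hRR x
  have hre : RCLike.re ((a : ℝ) : ℂ) = a := by simp
  rw [hre] at hform
  have hform' : RCLike.re ⟪x, laplaceAk L m n φ η U hL αU hα1 hU1 hreg τ (c₀ := c₀) (c₁ := c₁) a x⟫_ℂ =
      RCLike.re ⟪x, hessOp φ η U τ x⟫_ℂ + ‖RofUk L m n φ η U (covDivL2K ℂ c₀ ((η : ℂ))⁻¹ (adTransportW φ fun b => (U b)⁻¹) x)‖ ^ 2 +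
        a * ‖QkW L m n φ U hL αU hα1 hU1 hreg (c₁ := c₁) x‖ ^ 2 := by
    rw [laplaceAk, laplaceALatticeK]; exact hform
  have hΔx := hΔ x
  have hR0 : 0 ≤ ‖RofUk L m n φ η U (covDivL2K ℂ c₀ ((η : ℂ))⁻¹ (adTransportW φ fun b => (U b)⁻¹) x)‖ ^ 2 := sq_nonneg _
  have hQ0 : 0 ≤ a * ‖QkW L m n φ U hL αU hα1 hU1 hreg (c₁ := c₁) x‖ ^ 2 := by positivity
  refine ⟨by rw [hrows] at hstrong; exact hstrong, ?_, ?_⟩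
  · linarith
  · linarith

/-! ## §2 The flat `D`-rows of `G_k(U)` -/

/-- **`‖curl₁(G_k(U)y)‖, ‖div₁(G_k(U)y)‖ ≤ γ₁⁻¹‖y‖` ON THE DIAGONAL** — the flat `D`-rows of the `k`-th-step Green's function at ANY positivity witness, from
§1 (i) by `B9Eq3153FrakGVariational.norm_apply_G1K_le` (`c_P = γ₁⁻¹`, `√(γ₁⁻¹∕γ₁) = γ₁⁻¹`); [B9] Thm 3.4 ∕ 3.3's `L²`-Sobolev shadow, no decay.
[cite: Balaban1985BackgroundPropagators, Thm 3.4 p.400, Thm 3.11 p.416] -/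
theorem exists_norm_G1k_rows_le_diagonal_closed :
    ∃ α₀ C : ℝ, 0 < α₀ ∧ 0 < C ∧ ∀ (n : ℕ) (η : ℝ), η * (L : ℝ) ^ (n + 1) = 1 →
      ∀ (c₀ c₁ : ℝ) [Fact (0 < c₀)] [Fact (0 < c₁)], c₀ * ((L : ℝ) ^ (n + 1)) ^ d = c₁ → |η| ^ d / c₀ ≤ ρw →
      ∀ (m : Fin d → ℕ) [∀ i, NeZero (m i)] (U : Bond d (towerP L m (n + 1)) → 𝔸ˣ) (αU : ℕ → ℝ) (hα1 : ∀ j, αU j ≤ 1 / 64)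
        (hU1 : ∀ (j : ℕ) (x : B7Prop1Explicit.Site d) (κ : Fin d), perCfg (towerP L m (j + 1)) (UlevOf L m (n + 1) U j) x κ ∈ U1 𝔸)
        (hreg : ∀ (j : ℕ) (y : TSite d (towerP L m j)) (κ : Fin d) (r : Fin d → Fin L),
          ‖((Wcx L (perCfg (towerP L m (j + 1)) (UlevOf L m (n + 1) U j)) (cornerSite L y) κ (boxVec L r) : 𝔸ˣ) : 𝔸) - 1‖ ≤ αU j)
        (εU : ℕ → ℝ), (∀ j, 0 ≤ εU j) → (∀ (j : ℕ) (b : Bond d (towerP L m (j + 1))), ‖(UlevOf L m (n + 1) U j b : 𝔸) - 1‖ ≤ εU j) →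
      ∀ {α : ℝ}, 0 ≤ α → α ≤ α₀ →
        (∀ (b : Bond d (towerP L m (n + 1))) (v u : W), ⟪adTransportW φ U b v, u⟫_ℂ = ⟪v, adTransportW φ (fun b => (U b)⁻¹) b u⟫_ℂ) →
        (∀ b, U b ∈ U1 𝔸) → (∀ b, ‖(U b : 𝔸) - 1‖ ≤ α * η) →
        (∀ p : B9SectCLatticeCarrier.Plaq d (towerP L m (n + 1)), ‖(plaqHolU U p : 𝔸) - 1‖ ≤ α * η ^ 2) →
        (∀ j < n + 1, εU j ≤ α * r ^ j) →
        ∀ (hpos : ∀ x : BondL2K ℂ d (towerP L m (n + 1)) c₀ W, x ≠ 0 →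
            0 < RCLike.re ⟪x, laplaceAk L m n φ η U hL αU hα1 hU1 hreg τ (c₀ := c₀) (c₁ := c₁) a x⟫_ℂ)
          (y : BondL2K ℂ d (towerP L m (n + 1)) c₀ W),
          ‖covCurlL2K ℂ c₀ ((η : ℂ))⁻¹ (adTransportW φ (fun _ : Bond d (towerP L m (n + 1)) => (1 : 𝔸ˣ))) (G1LatticeK hpos y)‖ ≤ C * ‖y‖ ∧
          ‖covDivL2K ℂ c₀ ((η : ℂ))⁻¹ (adTransportW φ fun _ : Bond d (towerP L m (n + 1)) => (1 : 𝔸ˣ)⁻¹) (G1LatticeK hpos y)‖ ≤ C * ‖y‖ := by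
  obtain ⟨α₀, γ₁, hα₀, hγ₁, H⟩ := exists_energy_letters_diagonal_closed L hL φ hMφ hMφ' hφ hφ' ha hr0 hr1 τ hτ hCτ hρw
  refine ⟨α₀, γ₁⁻¹, hα₀, by positivity, ?_⟩
  intro n η hηL c₀ c₁ _ _ hw hρ m _ U αU hα1 hU1 hreg εU hεU hUε α hα0 hαle hRS hUb hUη hpl hεg hpos y
  have Hx := H n η hηL c₀ c₁ hw hρ m U αU hα1 hU1 hreg εU hεU hUε hα0 hαle hRS hUb hUη hpl hεg
  have hcoer : ∀ x : BondL2K ℂ d (towerP L m (n + 1)) c₀ W,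
      γ₁ * ‖x‖ ^ 2 ≤ RCLike.re ⟪x, laplaceAk L m n φ η U hL αU hα1 hU1 hreg τ (c₀ := c₀) (c₁ := c₁) a x⟫_ℂ := fun x => (rows_of_strong hγ₁ (Hx x).1).1
  have hPc : ∀ x : BondL2K ℂ d (towerP L m (n + 1)) c₀ W,
      ‖covCurlL2K ℂ c₀ ((η : ℂ))⁻¹ (adTransportW φ (fun _ : Bond d (towerP L m (n + 1)) => (1 : 𝔸ˣ))) x‖ ^ 2 ≤
        γ₁⁻¹ * RCLike.re ⟪x, laplaceAk L m n φ η U hL αU hα1 hU1 hreg τ (c₀ := c₀) (c₁ := c₁) a x⟫_ℂ := fun x => (rows_of_strong hγ₁ (Hx x).1).2.1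
  have hPd : ∀ x : BondL2K ℂ d (towerP L m (n + 1)) c₀ W,
      ‖covDivL2K ℂ c₀ ((η : ℂ))⁻¹ (adTransportW φ fun _ : Bond d (towerP L m (n + 1)) => (1 : 𝔸ˣ)⁻¹) x‖ ^ 2 ≤
        γ₁⁻¹ * RCLike.re ⟪x, laplaceAk L m n φ η U hL αU hα1 hU1 hreg τ (c₀ := c₀) (c₁ := c₁) a x⟫_ℂ := fun x => (rows_of_strong hγ₁ (Hx x).1).2.2
  have hsq : Real.sqrt (γ₁⁻¹ / γ₁) = γ₁⁻¹ := by
    rw [div_eq_mul_inv, Real.sqrt_mul_self (inv_nonneg.2 hγ₁.le)]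
  constructor
  · calc _ ≤ Real.sqrt (γ₁⁻¹ / γ₁) * ‖y‖ := norm_apply_G1K_le (𝕜 := ℂ) hpos hγ₁ hcoer
          (covCurlL2K ℂ c₀ ((η : ℂ))⁻¹ (adTransportW φ (fun _ : Bond d (towerP L m (n + 1)) => (1 : 𝔸ˣ)))) (inv_nonneg.2 hγ₁.le) hPc y
      _ = γ₁⁻¹ * ‖y‖ := by rw [hsq]
  · calc _ ≤ Real.sqrt (γ₁⁻¹ / γ₁) * ‖y‖ := norm_apply_G1K_le (𝕜 := ℂ) hpos hγ₁ hcoer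
          (covDivL2K ℂ c₀ ((η : ℂ))⁻¹ (adTransportW φ fun _ : Bond d (towerP L m (n + 1)) => (1 : 𝔸ˣ)⁻¹)) (inv_nonneg.2 hγ₁.le) hPd y
      _ = γ₁⁻¹ * ‖y‖ := by rw [hsq]

/-! ## §3 `H_{1,k}(U)Q_k(U)G_k(U)` and its flat `D`-rows -/

-- deep definitional unfolding of the composite letters `H1LatticeK`∕`frakGLatticeK` ↦ `H1K`∕`frakGLin` (as in `B11Eq174ChartContinuityAtFlat`)
set_option maxRecDepth 8192 in
/-- **`‖H_{1,k}(U)(Q_k(U)(G_k(U)y))‖, ‖curl₁(…)‖, ‖div₁(…)‖ ≤ γ₁⁻¹‖y‖` ON THE DIAGONAL, NO `H`-LETTER** — the second piece of (3.153): `H_{1,k}b` minimises the energy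
on `{Q_kx = b}` ([B11] (45)) and `G_k(U)y` is admissible for `b = Q_k(G_ky)`; for `Δ^{(n+1)}_a(U)` symmetric (`hsymm`: `B9Eq326OperatorTower.laplaceAk_isSymmetric` for a
unitary background and a `*`-trace), ANY positivity witness and ANY onto-witness of `Q_k(U)` (`B9Eq3153FrakGVariational` §3 at §1's letters).
[cite: Balaban1985BackgroundPropagators, (3.126) p.420, (3.153) p.426, Thm 3.11 p.416; Balaban1985Variational, (45) p.285] -/
theorem exists_norm_H1k_Qk_G1k_le_diagonal_closed :
    ∃ α₀ C : ℝ, 0 < α₀ ∧ 0 < C ∧ ∀ (n : ℕ) (η : ℝ), η * (L : ℝ) ^ (n + 1) = 1 →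
      ∀ (c₀ c₁ : ℝ) [Fact (0 < c₀)] [Fact (0 < c₁)], c₀ * ((L : ℝ) ^ (n + 1)) ^ d = c₁ → |η| ^ d / c₀ ≤ ρw →
      ∀ (m : Fin d → ℕ) [∀ i, NeZero (m i)] (U : Bond d (towerP L m (n + 1)) → 𝔸ˣ) (αU : ℕ → ℝ) (hα1 : ∀ j, αU j ≤ 1 / 64)
        (hU1 : ∀ (j : ℕ) (x : B7Prop1Explicit.Site d) (κ : Fin d), perCfg (towerP L m (j + 1)) (UlevOf L m (n + 1) U j) x κ ∈ U1 𝔸)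
        (hreg : ∀ (j : ℕ) (y : TSite d (towerP L m j)) (κ : Fin d) (r : Fin d → Fin L),
          ‖((Wcx L (perCfg (towerP L m (j + 1)) (UlevOf L m (n + 1) U j)) (cornerSite L y) κ (boxVec L r) : 𝔸ˣ) : 𝔸) - 1‖ ≤ αU j)
        (εU : ℕ → ℝ), (∀ j, 0 ≤ εU j) → (∀ (j : ℕ) (b : Bond d (towerP L m (j + 1))), ‖(UlevOf L m (n + 1) U j b : 𝔸) - 1‖ ≤ εU j) →
      ∀ {α : ℝ}, 0 ≤ α → α ≤ α₀ →
        (∀ (b : Bond d (towerP L m (n + 1))) (v u : W), ⟪adTransportW φ U b v, u⟫_ℂ = ⟪v, adTransportW φ (fun b => (U b)⁻¹) b u⟫_ℂ) →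
        (∀ b, U b ∈ U1 𝔸) → (∀ b, ‖(U b : 𝔸) - 1‖ ≤ α * η) →
        (∀ p : B9SectCLatticeCarrier.Plaq d (towerP L m (n + 1)), ‖(plaqHolU U p : 𝔸) - 1‖ ≤ α * η ^ 2) →
        (∀ j < n + 1, εU j ≤ α * r ^ j) →
        (laplaceAk L m n φ η U hL αU hα1 hU1 hreg τ (c₀ := c₀) (c₁ := c₁) a).IsSymmetric →
        ∀ (hpos : ∀ x : BondL2K ℂ d (towerP L m (n + 1)) c₀ W, x ≠ 0 →
            0 < RCLike.re ⟪x, laplaceAk L m n φ η U hL αU hα1 hU1 hreg τ (c₀ := c₀) (c₁ := c₁) a x⟫_ℂ)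
          (hQ : Function.Surjective (QkW L m n φ U hL αU hα1 hU1 hreg (c₁ := c₁)))
          (y : BondL2K ℂ d (towerP L m (n + 1)) c₀ W),
          ‖H1LatticeK hpos hQ (QkW L m n φ U hL αU hα1 hU1 hreg (c₁ := c₁) (G1LatticeK hpos y))‖ ≤ C * ‖y‖ ∧
          ‖covCurlL2K ℂ c₀ ((η : ℂ))⁻¹ (adTransportW φ (fun _ : Bond d (towerP L m (n + 1)) => (1 : 𝔸ˣ)))
              (H1LatticeK hpos hQ (QkW L m n φ U hL αU hα1 hU1 hreg (c₁ := c₁) (G1LatticeK hpos y)))‖ ≤ C * ‖y‖ ∧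
          ‖covDivL2K ℂ c₀ ((η : ℂ))⁻¹ (adTransportW φ fun _ : Bond d (towerP L m (n + 1)) => (1 : 𝔸ˣ)⁻¹)
              (H1LatticeK hpos hQ (QkW L m n φ U hL αU hα1 hU1 hreg (c₁ := c₁) (G1LatticeK hpos y)))‖ ≤ C * ‖y‖ := by
  obtain ⟨α₀, γ₁, hα₀, hγ₁, H⟩ := exists_energy_letters_diagonal_closed L hL φ hMφ hMφ' hφ hφ' ha hr0 hr1 τ hτ hCτ hρw
  refine ⟨α₀, γ₁⁻¹, hα₀, by positivity, ?_⟩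
  intro n η hηL c₀ c₁ _ _ hw hρ m _ U αU hα1 hU1 hreg εU hεU hUε α hα0 hαle hRS hUb hUη hpl hεg hsymm hpos hQ y
  have Hx := H n η hηL c₀ c₁ hw hρ m U αU hα1 hU1 hreg εU hεU hUε hα0 hαle hRS hUb hUη hpl hεg
  have hcoer : ∀ x : BondL2K ℂ d (towerP L m (n + 1)) c₀ W,
      γ₁ * ‖x‖ ^ 2 ≤ RCLike.re ⟪x, laplaceAk L m n φ η U hL αU hα1 hU1 hreg τ (c₀ := c₀) (c₁ := c₁) a x⟫_ℂ := fun x => (rows_of_strong hγ₁ (Hx x).1).1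
  have hPc : ∀ x : BondL2K ℂ d (towerP L m (n + 1)) c₀ W,
      ‖covCurlL2K ℂ c₀ ((η : ℂ))⁻¹ (adTransportW φ (fun _ : Bond d (towerP L m (n + 1)) => (1 : 𝔸ˣ))) x‖ ^ 2 ≤
        γ₁⁻¹ * RCLike.re ⟪x, laplaceAk L m n φ η U hL αU hα1 hU1 hreg τ (c₀ := c₀) (c₁ := c₁) a x⟫_ℂ := fun x => (rows_of_strong hγ₁ (Hx x).1).2.1
  have hPd : ∀ x : BondL2K ℂ d (towerP L m (n + 1)) c₀ W,
      ‖covDivL2K ℂ c₀ ((η : ℂ))⁻¹ (adTransportW φ fun _ : Bond d (towerP L m (n + 1)) => (1 : 𝔸ˣ)⁻¹) x‖ ^ 2 ≤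
        γ₁⁻¹ * RCLike.re ⟪x, laplaceAk L m n φ η U hL αU hα1 hU1 hreg τ (c₀ := c₀) (c₁ := c₁) a x⟫_ℂ := fun x => (rows_of_strong hγ₁ (Hx x).1).2.2
  have hsq : Real.sqrt (γ₁⁻¹ / γ₁) = γ₁⁻¹ := by
    rw [div_eq_mul_inv, Real.sqrt_mul_self (inv_nonneg.2 hγ₁.le)]
  have hadj : ∀ (x : BondL2K ℂ d (towerP L m (n + 1)) c₀ W) (z : BondL2K ℂ d m c₁ W),
      ⟪QkW L m n φ U hL αU hα1 hU1 hreg (c₁ := c₁) x, z⟫_ℂ = ⟪x, LinearMap.adjoint (QkW L m n φ U hL αU hα1 hU1 hreg (c₁ := c₁)) z⟫_ℂ :=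
    fun x z => (LinearMap.adjoint_inner_right _ x z).symm
  have hinj := adjoint_injective_of_surjective _ hQ
  refine ⟨?_, ?_, ?_⟩
  · exact norm_H1K_Q_G1K_le (𝕜 := ℂ) hpos hadj hinj hγ₁ hcoer hsymm y
  · exact le_of_le_of_eq (norm_apply_H1K_Q_G1K_le (𝕜 := ℂ) hpos hadj hinj hγ₁ hcoer
      (covCurlL2K ℂ c₀ ((η : ℂ))⁻¹ (adTransportW φ (fun _ : Bond d (towerP L m (n + 1)) => (1 : 𝔸ˣ)))) (inv_nonneg.2 hγ₁.le) hPc hsymm y) (by rw [hsq])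
  · exact le_of_le_of_eq (norm_apply_H1K_Q_G1K_le (𝕜 := ℂ) hpos hadj hinj hγ₁ hcoer
      (covDivL2K ℂ c₀ ((η : ℂ))⁻¹ (adTransportW φ fun _ : Bond d (towerP L m (n + 1)) => (1 : 𝔸ˣ)⁻¹)) (inv_nonneg.2 hγ₁.le) hPd hsymm y) (by rw [hsq])

/-! ## §4 The third Green's letter `𝔊_k(U)` and its flat `D`-rows -/

-- deep definitional unfolding of the composite letters `H1LatticeK`∕`frakGLatticeK` ↦ `H1K`∕`frakGLin` (as in `B11Eq174ChartContinuityAtFlat`)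
set_option maxRecDepth 8192 in
/-- **[B9] THM 3.13's `L²` CLAUSE FOR PRINT's `k`-TH-STEP `𝔊_k(U)` ON THE DIAGONAL, NO OPERATOR LETTER DISPLAYED**: there are `α₀, C > 0` (`C = 4γ₁⁻¹ = 16∕γ(d,a)`,
`α₀` closed in `(d, a, L, M_φ, M_φ′, r, C_τ, ρ_w)`) such that for every `n`, `η` (`ηL^{n+1} = 1`), `c₀, c₁` (`c₀(L^{n+1})^d = c₁`, `|η|^d∕c₀ ≤ ρ_w`), `m`, background `U`
of E162's data with `hRS`, the windows `‖U(b) − 1‖ ≤ αη`, `‖U(∂p) − 1‖ ≤ αη²`, `‖Ū^j(b) − 1‖ ≤ ε_j ≤ αr^j`, `0 ≤ α ≤ α₀`, `Δ^{(n+1)}_a(U)` symmetric, ANY positivity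
witness `hpos` and ANY onto-witness `hQ` of `Q_k(U)` (so for `B9Eq326OperatorTower.frakGk`): `‖𝔊_k(U)x‖ ≤ C‖x‖`, `‖curl₁(𝔊_k(U)x)‖ ≤ C‖x‖`, `‖div₁(𝔊_k(U)x)‖ ≤ C‖x‖`
— (3.153) in the energy currency (`B9Eq3153FrakGVariational.norm_frakGLin_le_of_energy` ∕ `norm_apply_frakGLin_le_of_energy` at §1's letters, `c_R = 2`, `c_P = γ₁⁻¹`).
LEVEL- AND VOLUME-FREE; no decay, no kernel bound. [cite: Balaban1985BackgroundPropagators, Thm 3.13 p.426, (3.153) p.426, Thm 3.11 p.416, (3.35) p.396] -/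
theorem exists_norm_frakGk_le_diagonal_closed :
    ∃ α₀ C : ℝ, 0 < α₀ ∧ 0 < C ∧ ∀ (n : ℕ) (η : ℝ), η * (L : ℝ) ^ (n + 1) = 1 →
      ∀ (c₀ c₁ : ℝ) [Fact (0 < c₀)] [Fact (0 < c₁)], c₀ * ((L : ℝ) ^ (n + 1)) ^ d = c₁ → |η| ^ d / c₀ ≤ ρw →
      ∀ (m : Fin d → ℕ) [∀ i, NeZero (m i)] (U : Bond d (towerP L m (n + 1)) → 𝔸ˣ) (αU : ℕ → ℝ) (hα1 : ∀ j, αU j ≤ 1 / 64)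
        (hU1 : ∀ (j : ℕ) (x : B7Prop1Explicit.Site d) (κ : Fin d), perCfg (towerP L m (j + 1)) (UlevOf L m (n + 1) U j) x κ ∈ U1 𝔸)
        (hreg : ∀ (j : ℕ) (y : TSite d (towerP L m j)) (κ : Fin d) (r : Fin d → Fin L),
          ‖((Wcx L (perCfg (towerP L m (j + 1)) (UlevOf L m (n + 1) U j)) (cornerSite L y) κ (boxVec L r) : 𝔸ˣ) : 𝔸) - 1‖ ≤ αU j)
        (εU : ℕ → ℝ), (∀ j, 0 ≤ εU j) → (∀ (j : ℕ) (b : Bond d (towerP L m (j + 1))), ‖(UlevOf L m (n + 1) U j b : 𝔸) - 1‖ ≤ εU j) →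
      ∀ {α : ℝ}, 0 ≤ α → α ≤ α₀ →
        (∀ (b : Bond d (towerP L m (n + 1))) (v u : W), ⟪adTransportW φ U b v, u⟫_ℂ = ⟪v, adTransportW φ (fun b => (U b)⁻¹) b u⟫_ℂ) →
        (∀ b, U b ∈ U1 𝔸) → (∀ b, ‖(U b : 𝔸) - 1‖ ≤ α * η) →
        (∀ p : B9SectCLatticeCarrier.Plaq d (towerP L m (n + 1)), ‖(plaqHolU U p : 𝔸) - 1‖ ≤ α * η ^ 2) →
        (∀ j < n + 1, εU j ≤ α * r ^ j) →
        (laplaceAk L m n φ η U hL αU hα1 hU1 hreg τ (c₀ := c₀) (c₁ := c₁) a).IsSymmetric →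
        ∀ (hpos : ∀ x : BondL2K ℂ d (towerP L m (n + 1)) c₀ W, x ≠ 0 →
            0 < RCLike.re ⟪x, laplaceAk L m n φ η U hL αU hα1 hU1 hreg τ (c₀ := c₀) (c₁ := c₁) a x⟫_ℂ)
          (hQ : Function.Surjective (QkW L m n φ U hL αU hα1 hU1 hreg (c₁ := c₁)))
          (x : BondL2K ℂ d (towerP L m (n + 1)) c₀ W),
          ‖frakGLatticeK hpos hQ x‖ ≤ C * ‖x‖ ∧
          ‖covCurlL2K ℂ c₀ ((η : ℂ))⁻¹ (adTransportW φ (fun _ : Bond d (towerP L m (n + 1)) => (1 : 𝔸ˣ))) (frakGLatticeK hpos hQ x)‖ ≤ C * ‖x‖ ∧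
          ‖covDivL2K ℂ c₀ ((η : ℂ))⁻¹ (adTransportW φ fun _ : Bond d (towerP L m (n + 1)) => (1 : 𝔸ˣ)⁻¹) (frakGLatticeK hpos hQ x)‖ ≤ C * ‖x‖ := by
  obtain ⟨α₀, γ₁, hα₀, hγ₁, H⟩ := exists_energy_letters_diagonal_closed L hL φ hMφ hMφ' hφ hφ' ha hr0 hr1 τ hτ hCτ hρw
  refine ⟨α₀, 4 * γ₁⁻¹, hα₀, by positivity, ?_⟩
  intro n η hηL c₀ c₁ _ _ hw hρ m _ U αU hα1 hU1 hreg εU hεU hUε α hα0 hαle hRS hUb hUη hpl hεg hsymm hpos hQ x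
  have hLr : (0 : ℝ) < (L : ℝ) ^ (n + 1) := pow_pos (by exact_mod_cast Nat.pos_of_ne_zero (NeZero.ne L)) _
  have hηL0 : 0 < η * (L : ℝ) ^ (n + 1) := by rw [hηL]; exact one_pos
  have hη0 : 0 < η := pos_of_mul_pos_left hηL0 hLr.le
  have hc : conj ((η : ℂ))⁻¹ = ((η : ℂ))⁻¹ := by rw [map_inv₀, Complex.conj_ofReal]
  have Hx := H n η hηL c₀ c₁ hw hρ m U αU hα1 hU1 hreg εU hεU hUε hα0 hαle hRS hUb hUη hpl hεg
  have hcoer : ∀ x : BondL2K ℂ d (towerP L m (n + 1)) c₀ W,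
      γ₁ * ‖x‖ ^ 2 ≤ RCLike.re ⟪x, laplaceAk L m n φ η U hL αU hα1 hU1 hreg τ (c₀ := c₀) (c₁ := c₁) a x⟫_ℂ := fun x => (rows_of_strong hγ₁ (Hx x).1).1
  have hPc : ∀ x : BondL2K ℂ d (towerP L m (n + 1)) c₀ W,
      ‖covCurlL2K ℂ c₀ ((η : ℂ))⁻¹ (adTransportW φ (fun _ : Bond d (towerP L m (n + 1)) => (1 : 𝔸ˣ))) x‖ ^ 2 ≤
        γ₁⁻¹ * RCLike.re ⟪x, laplaceAk L m n φ η U hL αU hα1 hU1 hreg τ (c₀ := c₀) (c₁ := c₁) a x⟫_ℂ := fun x => (rows_of_strong hγ₁ (Hx x).1).2.1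
  have hPd : ∀ x : BondL2K ℂ d (towerP L m (n + 1)) c₀ W,
      ‖covDivL2K ℂ c₀ ((η : ℂ))⁻¹ (adTransportW φ fun _ : Bond d (towerP L m (n + 1)) => (1 : 𝔸ˣ)⁻¹) x‖ ^ 2 ≤
        γ₁⁻¹ * RCLike.re ⟪x, laplaceAk L m n φ η U hL αU hα1 hU1 hreg τ (c₀ := c₀) (c₁ := c₁) a x⟫_ℂ := fun x => (rows_of_strong hγ₁ (Hx x).1).2.2
  have hRD : ∀ x : BondL2K ℂ d (towerP L m (n + 1)) c₀ W,
      ‖RofUk L m n φ η U (covDivL2K ℂ c₀ ((η : ℂ))⁻¹ (adTransportW φ fun b => (U b)⁻¹) x)‖ ^ 2 ≤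
        2 * RCLike.re ⟪x, laplaceAk L m n φ η U hL αU hα1 hU1 hreg τ (c₀ := c₀) (c₁ := c₁) a x⟫_ℂ := fun x => (Hx x).2.1
  have hsq : Real.sqrt (γ₁⁻¹ / γ₁) = γ₁⁻¹ := by
    rw [div_eq_mul_inv, Real.sqrt_mul_self (inv_nonneg.2 hγ₁.le)]
  have hadj : ∀ (x : BondL2K ℂ d (towerP L m (n + 1)) c₀ W) (z : BondL2K ℂ d m c₁ W),
      ⟪QkW L m n φ U hL αU hα1 hU1 hreg (c₁ := c₁) x, z⟫_ℂ = ⟪x, LinearMap.adjoint (QkW L m n φ U hL αU hα1 hU1 hreg (c₁ := c₁)) z⟫_ℂ :=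
    fun x z => (LinearMap.adjoint_inner_right _ x z).symm
  have hinj := adjoint_injective_of_surjective _ hQ
  have hDD : ∀ (s : SiteL2K ℂ d (towerP L m (n + 1)) c₀ W) (y : BondL2K ℂ d (towerP L m (n + 1)) c₀ W),
      ⟪covDerivL2K ℂ c₀ ((η : ℂ))⁻¹ (adTransportW φ U) s, y⟫_ℂ = ⟪s, covDivL2K ℂ c₀ ((η : ℂ))⁻¹ (adTransportW φ fun b => (U b)⁻¹) y⟫_ℂ := by
    intro s y
    rw [← adjoint_covDerivL2K ((η : ℂ))⁻¹ hc _ _ hRS, LinearMap.adjoint_inner_right]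
  have hRsym : ∀ s t : SiteL2K ℂ d (towerP L m (n + 1)) c₀ W, ⟪RofUk L m n φ η U s, t⟫_ℂ = ⟪s, RofUk L m n φ η U t⟫_ℂ :=
    fun s t => RofUk_isSymmetric L m n φ η U s t
  have hRR : ∀ s : SiteL2K ℂ d (towerP L m (n + 1)) c₀ W, RofUk L m n φ η U (RofUk L m n φ η U s) = RofUk L m n φ η U s :=
    fun s => projR_projR _ _ s
  refine ⟨?_, ?_, ?_⟩
  · calc _ ≤ (2 + 2) * γ₁⁻¹ * ‖x‖ := norm_frakGLin_le_of_energy (𝕜 := ℂ) hpos hadj hinj hγ₁ hcoer hsymm hDD hRsym hRR (by norm_num : (0 : ℝ) ≤ 2) hRD x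
      _ = 4 * γ₁⁻¹ * ‖x‖ := by norm_num
  · exact le_of_le_of_eq (norm_apply_frakGLin_le_of_energy (𝕜 := ℂ) hpos hadj hinj hγ₁ hcoer
      (covCurlL2K ℂ c₀ ((η : ℂ))⁻¹ (adTransportW φ (fun _ : Bond d (towerP L m (n + 1)) => (1 : 𝔸ˣ)))) (inv_nonneg.2 hγ₁.le) hPc hsymm hDD hRsym hRR (by norm_num : (0 : ℝ) ≤ 2) hRD x) (by rw [hsq]; norm_num)
  · exact le_of_le_of_eq (norm_apply_frakGLin_le_of_energy (𝕜 := ℂ) hpos hadj hinj hγ₁ hcoer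
      (covDivL2K ℂ c₀ ((η : ℂ))⁻¹ (adTransportW φ fun _ : Bond d (towerP L m (n + 1)) => (1 : 𝔸ˣ)⁻¹)) (inv_nonneg.2 hγ₁.le) hPd hsymm hDD hRsym hRR (by norm_num : (0 : ℝ) ≤ 2) hRD x) (by rw [hsq]; norm_num)

end Literature.MathematicalPhysics.QuantumFieldTheory.Balaban1983to89.B9Eq3153FrakGkBoundDiagonal

end
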